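import Literature.Analysis.FluidPDE.TypeIAncientMild
import Literature.Analysis.FluidPDE.KNSSTypeIRateLiouvilleMild
import HarnessLib

/-!
# `TypeIliouvilleNoTypeII` (stmt-NavierStokesRegularity-0056), line `Sketch` — STUB 6:
# the Liouville conjecture (L) implies the eternal Liouville statement

Support file (`--supports stmt-NavierStokesRegularity-0056`) for the crux
`Summit.NavierStokesRegularity.NavierStokesRegularity.Theses.TypeILiouville.TypeIliouvilleNoTypeII`
(no Type-II blow-up), line `Sketch` (immortal zoom). The line reduces the crux to an ETERNAL
Liouville statement: a bounded smooth divergence-free field `v` on `ℝ × ℝ³` satisfying the Oseen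
integral equation `v(t) = e^{(t-s)Δ}v(s) - B¹_s(v,v)(t)` between all pairs of times `s < t` (unit
viscosity) has zero spatial gradient. This file proves that the Liouville conjecture (L) of
Koch–Nadirashvili–Seregin–Šverák (2009, §1; route item `TypeIliouvilleL` =
`Literature.Analysis.FluidPDE.LiouvilleConjectureNS`: bounded ancient mild solutions in the
duality sense with measurable slices are a.e. constant on every slice `t < 0`) implies it.

* `isBoundedAncientMildSolution_translate`: every time translate `s ↦ v(s + T)` of such a field,
  restricted to `s < 0`, is a bounded ancient mild solution in the duality sense of
  `SelfSimilar.lean` — it is jointly continuous, bounded, has weakly divergence-free slices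
  (`VectorCalculus.IsDivFree.isWeaklyDivFree_holds`) and solves the Oseen equation between all
  `s < s' < 0` (the equation is autonomous, `oseenDuhamel_comp_sub_right`), so the tree's
  `isBoundedAncientMildSolution_of_oseen` (Lemarié-Rieusset 2016, Thm. 6.1: Oseen solutions are
  very weak solutions) applies.
* `stub_eternalLiouville_of_liouvilleConjecture`: fix `t, x`; (L) applied to `w(s) = v(s + t + 1)`
  at `s = -1` makes `v(t) = w(-1)` a.e. equal to a constant; the slice is continuous, so it is
  constant (`Continuous.ae_eq_iff_eq`), hence `fderiv ℝ (v t) x = 0`.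

## References

* G. Koch, N. Nadirashvili, G. Seregin, V. Šverák, *Liouville theorems for the Navier–Stokes
  equations and applications*, Acta Math. 203 (2009) 83–105 = arXiv:0709.3599, §1 (conjecture
  (L)), §4 p. 8 (mild solutions, the bilinear form `B`).
* P. G. Lemarié-Rieusset, *The Navier–Stokes problem in the 21st century* (2016), Thm. 6.1
  ((6.12) ⇒ (6.11)).
-/

set_option linter.dupNamespace false

noncomputable section

open Set Function Filter Topology MeasureTheory
open Literature.Analysis Literature.Analysis.FluidPDE

namespace Summit.NavierStokesRegularity.NavierStokesRegularity.Theorems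

namespace TypeIliouvilleNoTypeII.ImmortalZoom

/-- `ℝ³` (the notation of the line's skeleton; the registered stub headers are spelled with it). -/
local notation "E3" => EuclideanSpace ℝ (Fin 3)

/-- **Time translates of a bounded eternal Oseen-mild smooth field are bounded ancient mild
solutions.** Let `v : ℝ → ℝ³ → ℝ³` be jointly smooth, with divergence-free slices, bounded, and
satisfy `v(t) = e^{(t-s)Δ}v(s) - B¹_s(v,v)(t)` pointwise for all `s < t`. Then for every `T` the
translate `s ↦ v(s + T)` is a bounded ancient mild solution in the duality sense
(`IsBoundedAncientMildSolution 1`): it is jointly continuous and bounded on `(-∞, 0) × ℝ³`, its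
slices are weakly divergence free (Gauss–Green, `VectorCalculus.IsDivFree.isWeaklyDivFree_holds`),
and it solves the Oseen equation between all `s < s' < 0` (the equation is autonomous,
`oseenDuhamel_comp_sub_right`), so `isBoundedAncientMildSolution_of_oseen` (Oseen solutions are
very weak solutions, Lemarié-Rieusset 2016, Thm. 6.1) applies. -/
theorem isBoundedAncientMildSolution_translate (v : ℝ → E3 → E3)
    (hv : ContDiff ℝ (⊤ : ℕ∞) (uncurry v)) (hdiv : ∀ t, VectorCalculus.IsDivFree (v t))
    (hmild : ∀ s t : ℝ, s < t → ∀ x, v t x = heatFlow (v s) (t - s) x - oseenDuhamel 1 s v v t x)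
    (hbdd : ∃ C : ℝ, ∀ t x, ‖v t x‖ ≤ C) (T : ℝ) :
    IsBoundedAncientMildSolution 1 (fun s => v (s + T)) := by
  have hslice : ∀ τ, ContDiff ℝ (⊤ : ℕ∞) (v τ) := fun τ => hv.comp (contDiff_prodMk_right τ)
  refine isBoundedAncientMildSolution_of_oseen one_pos ?_ ?_ ?_ ?_
  · -- joint continuity of the translate
    have e : (uncurry fun s x => v (s + T) x) = uncurry v ∘ fun p : ℝ × E3 => (p.1 + T, p.2) :=
      rfl
    rw [e]
    exact (hv.continuous.comp (by fun_prop)).continuousOn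
  · -- boundedness
    obtain ⟨C, hC⟩ := hbdd
    exact ⟨C, fun t _ x => hC (t + T) x⟩
  · -- weakly divergence-free slices
    intro t _
    exact VectorCalculus.IsDivFree.isWeaklyDivFree_holds (hdiv (t + T))
      ((hslice (t + T)).of_le (by exact_mod_cast le_top))
  · -- the Oseen equation of the translate
    intro s t hst _ x
    show v (t + T) x = UnboundedOperators.heatExtension (v (s + T)) (1 * (t - s)) x -
        oseenDuhamel 1 s (fun τ => v (τ + T)) (fun τ => v (τ + T)) t x
    have hst' : s + T < t + T := by linarith
    rw [hmild (s + T) (t + T) hst' x, heatFlow_of_pos _ (sub_pos.2 hst'), one_mul,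
      add_sub_add_right_eq_sub]
    congr 1
    simpa only [sub_neg_eq_add] using (oseenDuhamel_comp_sub_right 1 s t (-T) v v x).symm

/-- **STUB 6: the Liouville conjecture (L) of Koch–Nadirashvili–Seregin–Šverák implies the eternal
Liouville statement of line `Sketch`.** Assume (L) verbatim as the route item `TypeIliouvilleL`
(`Literature.Analysis.FluidPDE.LiouvilleConjectureNS`): every bounded ancient mild solution (unit
viscosity, duality sense) with a.e. strongly measurable slices is a.e. constant on every slice
`t < 0`. Then a bounded, jointly smooth, divergence-free field `v` on `ℝ × ℝ³` solving the Oseen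
integral equation `v(t) = e^{(t-s)Δ}v(s) - B¹_s(v,v)(t)` between all `s < t` has identically
vanishing spatial gradient: for fixed `t`, the translate `w(s) = v(s + t + 1)` is a bounded ancient
mild solution (`isBoundedAncientMildSolution_translate`) with continuous slices, (L) at `s = -1`
makes `v(t) = w(-1)` a.e. constant, continuity upgrades this to `v(t) ≡ b`
(`Continuous.ae_eq_iff_eq`), and the derivative of a constant vanishes. -/
theorem stub_eternalLiouville_of_liouvilleConjecture
    (hL : ∀ u : ℝ → E3 → E3, IsBoundedAncientMildSolution 1 u →
      (∀ t < 0, AEStronglyMeasurable (u t) volume) → ∀ t < 0, ∃ b : E3, u t =ᵐ[volume] fun _ => b)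
    (v : ℝ → E3 → E3) (hv : ContDiff ℝ (⊤ : ℕ∞) (uncurry v))
    (hdiv : ∀ t, VectorCalculus.IsDivFree (v t))
    (hmild : ∀ s t : ℝ, s < t → ∀ x, v t x = heatFlow (v s) (t - s) x - oseenDuhamel 1 s v v t x)
    (hbdd : ∃ C : ℝ, ∀ t x, ‖v t x‖ ≤ C) : ∀ t x, fderiv ℝ (v t) x = 0 := by
  intro t x
  have hcont : ∀ τ, Continuous (v τ) := fun τ => (hv.comp (contDiff_prodMk_right τ)).continuous
  obtain ⟨b, hb⟩ := hL (fun s => v (s + (t + 1)))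
    (isBoundedAncientMildSolution_translate v hv hdiv hmild hbdd (t + 1))
    (fun s _ => (hcont (s + (t + 1))).aestronglyMeasurable) (-1) (by norm_num)
  have e : (-1 : ℝ) + (t + 1) = t := by ring
  have hb' : v t =ᵐ[volume] fun _ => b := by simpa only [e] using hb
  have hvt : v t = fun _ => b := ((hcont t).ae_eq_iff_eq volume continuous_const).1 hb'
  rw [hvt]
  exact fderiv_const_apply b

end TypeIliouvilleNoTypeII.ImmortalZoom

end Summit.NavierStokesRegularity.NavierStokesRegularity.Theorems
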